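import Summits.QuantumFields.BalabanUV.T4Continuum.Support.NE3QuadRemainderGaugedLetter
import Summits.QuantumFields.BalabanUV.T4Continuum.Support.NE3LinearTowerProfile
import HarnessLib

/-!
# T⁴ programme, node NE3 — route Π, item Π-C-3γ″, file γ-PROFILE: THE QUADRATIC LETTER OF THE LINEARISED AVERAGE FROM THE GAUGED TWO-TIER LEAF,
# WITH γ4″ DISCHARGED BY NAME — `GaugedTwoTier … (profd d) …` ∧ Π-C's tower class ∧ the fibre ∧ ONE k-free regime line `cK·Ssum ≤ 1∕2`
# ⟹ `‖dirIter L (j+1) W X₀ z κ‖ ≤ C^γ(d,L)·(L^{j+1})²·(m² + ℓ² + (Λ∕L^{j+1})²)(z,κ)`, `C^γ(d,L)` DISPLAYED and k-FREE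

NE3 (node U1b) formalisation swarm `b2b-balaban-t4-ne3-formalise-*`, LEAF PROVER 02 (gen 8; Π-C authors' lineage); design D-ne3leaf02g8-1 §4 (Γ″).
INPUTS BY NAME: γ-LETTER `NE3QuadRemainderGaugedLetter.norm_dirIter_le_of_gaugedTwoTier` ∕ `norm_dirIter_le_combined_of_gaugedTwoTier` (this lineage) and
γ4″ = leaf-04-g8's `NE3LinearTowerProfile.norm_dirIter_le_of_profile` (the Coulomb-profile letter of the linearised k-fold average: profile
`profd d v = ((1 + |v|₁∕2)^{d−2})⁻¹`, constants `Aσ d = 2 + 8d`, `Bβ d L`), which inhabits γ-END's displayed hypothesis `hlin` token for token.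

CONTENT (kernel; 0 def; [folklore]): **`norm_dirIter_le_of_gaugedTwoTier_profile`** (three-currency form) and **`norm_dirIter_le_combined_of_gaugedTwoTier_profile`**
(the owner's 4γ currency `C^γ·(L^{j+1}·m̂ z κ)²`, `m̂ := √(m² + ℓ² + (Λ∕L^{j+1})²)`; its `hsq` is γ-LETTER's `sq_combined_of_gaugedTwoTier`, `hm0` is `Real.sqrt_nonneg`), with
`C^γ(d,L) := 4(3+12d)³∕rho0 d L² + 10240((4(3+12d)+2)(3·2^d)² + 2·Aσ d + 3·Bβ d L·((d+1)·3·2^d)²)`.  The located `4 ≤ d` of the route enters through γ4″ (`hd`).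

HONEST FRAMING.  Composition of landed∕filed kernel files; the ONLY leaf is (Π-REG-γ″) `GaugedTwoTier` — a hypothesis SHAPE asserted for NO minimiser pair (zero datum
and synthetic witnesses only; for the pair it is B11 Thm 1∕Prop 2 regularity TYPE in the unpinned Landau gauge + the Coulomb structure of the pinning, NE3-R2's engine
evidence D-12-4, not a theorem); Π-C-3γ″ is thereby closed MODULO that leaf and nothing else; `DecomposedRep`'s sizes, (H∃), T-E_w♯ and NE3 are NOT proved; spine
PROVED 0∕9; finite T⁴ rung (B)+1 — NOT infinite volume, NOT mass gap, NOT `BetaPertH`, NOT Clay.  PLACEMENT: `Summits/QuantumFields/BalabanUV/`.  HONEST DEPENDENCY: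
continuum YM on T⁴ ⇐ BetaPertH ∧ nine spine estimates (0/9 proved); BetaPertH ⇐ (D1) ∧ (D4) ∧ CAP+tail; G-an2-4 gates asym, D1 and NE2/3/4.
-/

set_option autoImplicit false

open scoped BigOperators Matrix.Norms.L2Operator
open NormedSpace Finset

namespace Summit.QuantumFields.BalabanUV.T4Continuum.NE3QuadRemainderGaugedProfile

open Literature.MathematicalPhysics.QuantumFieldTheory.Balaban1983to89
open B7Prop1Explicit B7Prop2Explicit
open B7Prop1Local (InBox loK bondHiK)
open T4AveragingDeficitWall (IsSkewDir IsUnitaryCfg SmallField vary dirSq)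
open T4AveragingDeficitWallBoundary (IsPeriodicCfg periodBox)
open AveragingDeficitPeriodicCounting (IsPeriodicDir)
open AveragingDeficitMultiLevelPrep (cavgIter LevelSmall)
open BlockAverageVaryDisc (rho0)
open NE3TangentCovariantTower (dirIter)
open NE3LinearisedAverageSup (curvSum)
open NE3CovariantLineSumsError (Ssum)
open NE3MajorantProfileTower (cK)
open NE3GaugedTwoTierShape (GaugedTwoTier)
open NE3LinearTowerProfile (profd profd_nonneg profd_le_one Aσ Bβ Aσ_nonneg Bβ_nonneg norm_dirIter_le_of_profile)
open NE3QuadRemainderGaugedLetter (norm_dirIter_le_of_gaugedTwoTier norm_dirIter_le_combined_of_gaugedTwoTier)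

noncomputable section

variable {d : ℕ} {n : Type*} [Fintype n] [DecidableEq n] [Nonempty n]

/-- **Π-C-3γ″ END, γ4″ DISCHARGED — THREE-CURRENCY FORM.**  Π-C's tower class at `W` (period `L^{j+1}·N`, `LevelSmall d L (j+1) x`, `SmallField W x`,
`curvSum ≤ (2∕3)L`) + γ4″'s regime line `cK d L (d−2)·Ssum d L (j+1) x ≤ 1∕2` + `4 ≤ d`; `X₀` skew periodic of sup `s₀` in the σ-regime with the fibre
equation; the varied configuration in the class with radius `x′`; the leaf `GaugedTwoTier L N (j+1) W X₀ (profd d) S m ℓ Λ C`; a uniform majorant `sm` of the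
companion tier in the σ- and BCH-regimes.  Then `‖dirIter L (j+1) W X₀ z κ‖ ≤ C^γ(d,L)·(L^{j+1})²·(m z κ² + ℓ z κ² + (Λ z κ∕L^{j+1})²)`. [folklore] -/
theorem norm_dirIter_le_of_gaugedTwoTier_profile {L N j : ℕ} [NeZero N] (hd : 4 ≤ d) (hL : 2 ≤ L) {W : Site d → Fin d → (Matrix n n ℂ)ˣ} {x : ℝ}
    (hWu : IsUnitaryCfg W) (hWP : IsPeriodicCfg W ((L ^ (j + 1) * N : ℕ) : ℤ)) (hx : 0 ≤ x) (hsm : LevelSmall d L (j + 1) x)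
    (hWx : SmallField W x) (hA : curvSum d L (j + 1) x ≤ 2 / 3 * L) (hK : cK d L (d - 2) * Ssum d L (j + 1) x ≤ 1 / 2)
    {X₀ : Site d → Fin d → Matrix n n ℂ} (hX₀s : IsSkewDir X₀) (hX₀P : IsPeriodicDir X₀ ((L ^ (j + 1) * N : ℕ) : ℤ))
    {s₀ : ℝ} (hs₀ : 0 ≤ s₀) (hX₀ : ∀ (y : Site d) (μ : Fin d), ‖X₀ y μ‖ ≤ s₀) (hσ₀ : 4 * (3 + 12 * (d : ℝ)) ^ 2 * (L : ℝ) ^ (j + 1) * s₀ ≤ rho0 d L ^ 2)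
    (hfib : cavgIter L (j + 1) (vary W X₀ 1) = cavgIter L (j + 1) W)
    {x' : ℝ} (hx' : 0 ≤ x') (hsm' : LevelSmall d L j x') (hAx' : SmallField (vary W X₀ 1) x')
    {S : Site d → Fin d → Finset (Site d)} {m ℓ Λ : Site d → Fin d → ℝ} {C : ℝ}
    (hG : GaugedTwoTier L N (j + 1) W X₀ (profd d) S m ℓ Λ C)
    {sm : ℝ} (hms : ∀ (z : Site d) (κ : Fin d), m z κ ≤ sm)
    (hσsm : 4 * (3 + 12 * (d : ℝ)) ^ 2 * (L : ℝ) ^ (j + 1) * sm ≤ rho0 d L ^ 2) (hsm8 : 2 * (3 + 12 * (d : ℝ)) * (L : ℝ) ^ (j + 1) * sm ≤ 1 / 8192)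
    (z : Site d) (κ : Fin d) :
    ‖dirIter L (j + 1) W X₀ z κ‖
      ≤ (4 * (3 + 12 * (d : ℝ)) ^ 3 / rho0 d L ^ 2
            + 10240 * ((4 * (3 + 12 * (d : ℝ)) + 2) * (3 * 2 ^ d) ^ 2 + 2 * Aσ d + 3 * Bβ d L * ((d + 1) * (3 * 2 ^ d)) ^ 2))
          * (((L : ℝ) ^ (j + 1)) ^ 2 * (m z κ ^ 2 + ℓ z κ ^ 2 + (Λ z κ / (L : ℝ) ^ (j + 1)) ^ 2)) :=
  norm_dirIter_le_of_gaugedTwoTier hL hWu hWP hx hsm hWx hA hX₀s hX₀P hs₀ hX₀ hσ₀ hfib hx' hsm' hAx' (profd_nonneg d) (profd_le_one d) hG hms hσsm hsm8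
    z κ (Aσ_nonneg d) (Bβ_nonneg d L)
    (fun _ S' _ _ hYs hYP hσ hβ hY => norm_dirIter_le_of_profile hd hL j hWu hWP hx hsm hWx hK z κ hYs hYP S' hσ hβ hY)

/-- **Π-C-3γ″ END, γ4″ DISCHARGED — THE OWNER'S 4γ CURRENCY**: same hypotheses; `‖dirIter L (j+1) W X₀ z κ‖ ≤ C^γ(d,L)·(L^{j+1}·m̂ z κ)²` with
`m̂ z κ := √(m z κ² + ℓ z κ² + (Λ z κ∕L^{j+1})²)` — `NE3DecomposedRepOfQuadLetter.decomposedRep_of_quadLetter`'s `hφ` with `C₂ := C^γ(d,L)`, `m := m̂`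
(`hsq` := `NE3QuadRemainderGaugedLetter.sq_combined_of_gaugedTwoTier`, `hm0` := `Real.sqrt_nonneg`). [folklore] -/
theorem norm_dirIter_le_combined_of_gaugedTwoTier_profile {L N j : ℕ} [NeZero N] (hd : 4 ≤ d) (hL : 2 ≤ L) {W : Site d → Fin d → (Matrix n n ℂ)ˣ}
    {x : ℝ} (hWu : IsUnitaryCfg W) (hWP : IsPeriodicCfg W ((L ^ (j + 1) * N : ℕ) : ℤ)) (hx : 0 ≤ x) (hsm : LevelSmall d L (j + 1) x)
    (hWx : SmallField W x) (hA : curvSum d L (j + 1) x ≤ 2 / 3 * L) (hK : cK d L (d - 2) * Ssum d L (j + 1) x ≤ 1 / 2)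
    {X₀ : Site d → Fin d → Matrix n n ℂ} (hX₀s : IsSkewDir X₀) (hX₀P : IsPeriodicDir X₀ ((L ^ (j + 1) * N : ℕ) : ℤ))
    {s₀ : ℝ} (hs₀ : 0 ≤ s₀) (hX₀ : ∀ (y : Site d) (μ : Fin d), ‖X₀ y μ‖ ≤ s₀) (hσ₀ : 4 * (3 + 12 * (d : ℝ)) ^ 2 * (L : ℝ) ^ (j + 1) * s₀ ≤ rho0 d L ^ 2)
    (hfib : cavgIter L (j + 1) (vary W X₀ 1) = cavgIter L (j + 1) W)
    {x' : ℝ} (hx' : 0 ≤ x') (hsm' : LevelSmall d L j x') (hAx' : SmallField (vary W X₀ 1) x')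
    {S : Site d → Fin d → Finset (Site d)} {m ℓ Λ : Site d → Fin d → ℝ} {C : ℝ}
    (hG : GaugedTwoTier L N (j + 1) W X₀ (profd d) S m ℓ Λ C)
    {sm : ℝ} (hms : ∀ (z : Site d) (κ : Fin d), m z κ ≤ sm)
    (hσsm : 4 * (3 + 12 * (d : ℝ)) ^ 2 * (L : ℝ) ^ (j + 1) * sm ≤ rho0 d L ^ 2) (hsm8 : 2 * (3 + 12 * (d : ℝ)) * (L : ℝ) ^ (j + 1) * sm ≤ 1 / 8192)
    (z : Site d) (κ : Fin d) :
    ‖dirIter L (j + 1) W X₀ z κ‖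
      ≤ (4 * (3 + 12 * (d : ℝ)) ^ 3 / rho0 d L ^ 2
            + 10240 * ((4 * (3 + 12 * (d : ℝ)) + 2) * (3 * 2 ^ d) ^ 2 + 2 * Aσ d + 3 * Bβ d L * ((d + 1) * (3 * 2 ^ d)) ^ 2))
          * ((L : ℝ) ^ (j + 1) * Real.sqrt (m z κ ^ 2 + ℓ z κ ^ 2 + (Λ z κ / (L : ℝ) ^ (j + 1)) ^ 2)) ^ 2 :=
  norm_dirIter_le_combined_of_gaugedTwoTier hL hWu hWP hx hsm hWx hA hX₀s hX₀P hs₀ hX₀ hσ₀ hfib hx' hsm' hAx' (profd_nonneg d) (profd_le_one d) hG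
    hms hσsm hsm8 z κ (Aσ_nonneg d) (Bβ_nonneg d L)
    (fun _ S' _ _ hYs hYP hσ hβ hY => norm_dirIter_le_of_profile hd hL j hWu hWP hx hsm hWx hK z κ hYs hYP S' hσ hβ hY)

end

end Summit.QuantumFields.BalabanUV.T4Continuum.NE3QuadRemainderGaugedProfile
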